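import Summits.FinalStateConjecture.FinalStateConjecture.Theorems.EIHFluxBalanceInertialRecessionStubHigherOrderVariationPrep
import Summits.FinalStateConjecture.FinalStateConjecture.Theorems.EIHFluxBalanceInertialRecessionStubHigherOrderSliceJets
import Summits.FinalStateConjecture.FinalStateConjecture.Theorems.EIHFluxBalanceInertialRecessionStubHigherOrderRadius

/-!
# Route EIHFluxBalance — `InertialRecession` (E′), line `SketchCleanExcision`, skeleton r13,
# stub `stub_higherOrderSlaving` (EF): the painted summands in scaled master-function form, and
# jets of finite sums

Helper file for the crux `stmt-FinalStateConjecture-17403`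
(`Summit.FinalStateConjecture.FinalStateConjecture.Theses.EIHFluxBalance.InertialRecession`, E′),
registered stub `stub_higherOrderSlaving` (orders two and three of frozen-vacuum slaving).

* `higherOrder_summand_omegaForm` — with a representative frame `Λ̃` and re-centred path `c̃`
  painting the same summand, and any scale `ρ > 0`,
  `boostedKerrBilin (Λ s) (s, ξ s) M a z = η + (M/ρ) • ω(a/ρ, Λ̃(s)⁻¹, (z − c̃ s)/ρ)`
  (`…StubHigherOrderOmega`: master-function form and Kerr–Schild scaling), the two-variable field of
  the variation bounds `…StubHigherOrderVariation`; `higherOrder_summand_radius` — its painted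
  radius is `ρ⁻¹` times the painted radius of the crux;
* `higherOrder_contDiffOn_sliceFields` — the frozen field and the first three lab-time variations of
  a two-variable field smooth on an open set are smooth on the slice;
* `higherOrder_fderiv_sum₃` — the first three derivatives of a finite sum of fields smooth on an
  open set are the sums of the derivatives.

No definitions, no named facts, no `sorry`.
-/

set_option linter.dupNamespace false
set_option maxSynthPendingDepth 6
set_option synthInstance.maxHeartbeats 200000

noncomputable section

namespace Summit.FinalStateConjecture.FinalStateConjecture.Theorems.SublinearIsFree.Slaving

open scoped Topology ContDiff BigOperators
open Filter Set Function Literature.Geometry.Lorentzian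
  Summit.FinalStateConjecture.FinalStateConjecture.Theorems

/-! ### Jets of finite sums -/

/-- **The first three derivatives of a finite sum of fields smooth on an open set.** [folklore] -/
theorem higherOrder_fderiv_sum₃ {E F : Type*} [NormedAddCommGroup E] [NormedSpace ℝ E]
    [NormedAddCommGroup F] [NormedSpace ℝ F] [CompleteSpace F] {ι : Type*} (u : Finset ι)
    {f : ι → E → F} {U : Set E} (hU : IsOpen U) (hf : ∀ j ∈ u, ContDiffOn ℝ ∞ (f j) U) {x : E}
    (hx : x ∈ U) :
    fderiv ℝ (fun z ↦ ∑ j ∈ u, f j z) x = ∑ j ∈ u, fderiv ℝ (f j) x ∧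
    fderiv ℝ (fderiv ℝ (fun z ↦ ∑ j ∈ u, f j z)) x = ∑ j ∈ u, fderiv ℝ (fderiv ℝ (f j)) x ∧
    fderiv ℝ (fderiv ℝ (fderiv ℝ (fun z ↦ ∑ j ∈ u, f j z))) x =
      ∑ j ∈ u, fderiv ℝ (fderiv ℝ (fderiv ℝ (f j))) x := by
  have hd : ∀ {g : E → F}, ContDiffOn ℝ ∞ g U → ∀ z ∈ U, DifferentiableAt ℝ g z :=
    fun hg z hz ↦ (hg.contDiffAt (hU.mem_nhds hz)).differentiableAt (by simp)
  have hf' : ∀ j ∈ u, ContDiffOn ℝ ∞ (fderiv ℝ (f j)) U := fun j hj ↦ (hf j hj).fderiv_of_isOpen hU (by simp)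
  have hf'' : ∀ j ∈ u, ContDiffOn ℝ ∞ (fderiv ℝ (fderiv ℝ (f j))) U := fun j hj ↦
    (hf' j hj).fderiv_of_isOpen hU (by simp)
  have e1 : EqOn (fderiv ℝ (fun z ↦ ∑ j ∈ u, f j z)) (fun z ↦ ∑ j ∈ u, fderiv ℝ (f j) z) U :=
    fun z hz ↦ fderiv_fun_sum fun j hj ↦ hd (hf j hj) z hz
  have e2 : EqOn (fderiv ℝ (fderiv ℝ (fun z ↦ ∑ j ∈ u, f j z)))
      (fun z ↦ ∑ j ∈ u, fderiv ℝ (fderiv ℝ (f j)) z) U := by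
    intro z hz
    have hev : fderiv ℝ (fun z ↦ ∑ j ∈ u, f j z) =ᶠ[𝓝 z] fun z ↦ ∑ j ∈ u, fderiv ℝ (f j) z :=
      Filter.eventually_of_mem (hU.mem_nhds hz) e1
    rw [hev.fderiv_eq]
    exact fderiv_fun_sum fun j hj ↦ ((hf' j hj).contDiffAt (hU.mem_nhds hz)).differentiableAt (by simp)
  refine ⟨e1 hx, e2 hx, ?_⟩
  have hev : fderiv ℝ (fderiv ℝ (fun z ↦ ∑ j ∈ u, f j z)) =ᶠ[𝓝 x]
      fun z ↦ ∑ j ∈ u, fderiv ℝ (fderiv ℝ (f j)) z := Filter.eventually_of_mem (hU.mem_nhds hx) e2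
  rw [hev.fderiv_eq]
  exact fderiv_fun_sum fun j hj ↦ ((hf'' j hj).contDiffAt (hU.mem_nhds hx)).differentiableAt (by simp)

/-! ### Slice fields of a two-variable field -/

/-- **The frozen field and the lab-time variations of a two-variable field are smooth on the
slice.** [folklore] -/
theorem higherOrder_contDiffOn_sliceFields {F : Type*} [NormedAddCommGroup F] [NormedSpace ℝ F]
    [CompleteSpace F] {Φ : ℝ × E4 → F} {U : Set (ℝ × E4)} (hU : IsOpen U) (hΦ : ContDiffOn ℝ ∞ Φ U)
    (t : ℝ) :
    IsOpen {z : E4 | ((t, z) : ℝ × E4) ∈ U} ∧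
    ContDiffOn ℝ ∞ (fun z ↦ Φ (t, z)) {z : E4 | ((t, z) : ℝ × E4) ∈ U} ∧
    ContDiffOn ℝ ∞ (fun z ↦ deriv (fun s ↦ Φ (s, z)) t) {z : E4 | ((t, z) : ℝ × E4) ∈ U} ∧
    ContDiffOn ℝ ∞ (fun z ↦ iteratedDeriv 2 (fun s ↦ Φ (s, z)) t) {z : E4 | ((t, z) : ℝ × E4) ∈ U} ∧
    ContDiffOn ℝ ∞ (fun z ↦ iteratedDeriv 3 (fun s ↦ Φ (s, z)) t) {z : E4 | ((t, z) : ℝ × E4) ∈ U} := by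
  set Us : Set E4 := {z : E4 | ((t, z) : ℝ × E4) ∈ U} with hUs
  have hι : ContDiff ℝ ∞ (fun z : E4 ↦ ((t, z) : ℝ × E4)) := contDiff_prodMk_right t
  have hUso : IsOpen Us := hU.preimage hι.continuous
  have hmemU : ∀ z ∈ Us, ((t, z) : ℝ × E4) ∈ U := fun z hz ↦ hz
  have hΦ₁ : ContDiffOn ℝ ∞ (fderiv ℝ Φ) U := hΦ.fderiv_of_isOpen hU (by simp)
  have hΦ₂ : ContDiffOn ℝ ∞ (fderiv ℝ (fderiv ℝ Φ)) U := hΦ₁.fderiv_of_isOpen hU (by simp)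
  have hΦ₃ : ContDiffOn ℝ ∞ (fderiv ℝ (fderiv ℝ (fderiv ℝ Φ))) U := hΦ₂.fderiv_of_isOpen hU (by simp)
  set e : ℝ × E4 := ((1 : ℝ), (0 : E4)) with he
  have hQ₁c : ContDiffOn ℝ ∞ (fun z ↦ fderiv ℝ Φ (t, z) e) Us :=
    (hΦ₁.comp hι.contDiffOn hmemU).clm_apply contDiffOn_const
  have hQ₂c : ContDiffOn ℝ ∞ (fun z ↦ fderiv ℝ (fderiv ℝ Φ) (t, z) e e) Us :=
    ((hΦ₂.comp hι.contDiffOn hmemU).clm_apply contDiffOn_const).clm_apply contDiffOn_const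
  have hQ₃c : ContDiffOn ℝ ∞ (fun z ↦ fderiv ℝ (fderiv ℝ (fderiv ℝ Φ)) (t, z) e e e) Us :=
    (((hΦ₃.comp hι.contDiffOn hmemU).clm_apply contDiffOn_const).clm_apply contDiffOn_const).clm_apply
      contDiffOn_const
  refine ⟨hUso, hΦ.comp hι.contDiffOn hmemU, hQ₁c.congr fun z hz ↦ ?_, hQ₂c.congr fun z hz ↦ ?_,
    hQ₃c.congr fun z hz ↦ ?_⟩
  · exact (higherOrder_sliceVariation_eq_iteratedDeriv hU hΦ (hmemU z hz)).1
  · exact (higherOrder_sliceVariation_eq_iteratedDeriv hU hΦ (hmemU z hz)).2.1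
  · exact (higherOrder_sliceVariation_eq_iteratedDeriv hU hΦ (hmemU z hz)).2.2

/-! ### The painted summands in scaled master-function form -/

/-- **A painted summand in scaled master-function form.** [folklore] -/
theorem higherOrder_summand_omegaForm (Λ L' : ℝ → lorentzGroup) (ξ : ℝ → E3) (cc : ℝ → E4) (M a : ℝ)
    {ρ : ℝ} (hρ : 0 < ρ)
    (hcp : ∀ s z, boostedKerrBilin (Λ s) (E4.ofTimeSpace s (ξ s)) M a z = boostedKerrBilin (L' s) (cc s) M a z)
    (s : ℝ) (z : E4) :
    boostedKerrBilin (Λ s) (E4.ofTimeSpace s (ξ s)) M a z = Minkowski.bilin +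
      (M / ρ) • (fun p : ℝ × (E4 →L[ℝ] E4) × E4 ↦
        (Kerr.bilin 1 p.1 (p.2.1 p.2.2) - Minkowski.bilin).bilinearComp p.2.1 p.2.1)
        (ρ⁻¹ * a, (((L' s : E4 ≃L[ℝ] E4).symm : E4 ≃L[ℝ] E4) : E4 →L[ℝ] E4), ρ⁻¹ • (z - cc s)) := by
  rw [hcp s z]
  have h := higherOrder_boostedKerrBilin_sub_eq_omega (L' s) (cc s) M a z
  rw [higherOrder_omega_scaling a _ (z - cc s) hρ, smul_smul, ← div_eq_mul_inv] at h
  rw [← h, add_sub_cancel]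

/-- **The painted radius of the scaled form.** [folklore] -/
theorem higherOrder_summand_radius (L' : lorentzGroup) (cc : E4) (a : ℝ) {ρ : ℝ} (hρ : 0 < ρ) (z : E4) :
    Kerr.radius (ρ⁻¹ * a) ((((L' : E4 ≃L[ℝ] E4).symm : E4 ≃L[ℝ] E4) : E4 →L[ℝ] E4) (ρ⁻¹ • (z - cc))) =
      ρ⁻¹ * Kerr.radius a (poincareInv L' cc z) := by
  rw [map_smul, Kerr.radius_smul (inv_pos.2 hρ)]
  rfl

/-- **Registered one-line carrier form** (`higherOrder_summandRadius_EF`) of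
`higherOrder_summand_radius`. [folklore] -/
theorem higherOrder_summandRadius_EF : open Literature.Geometry.Lorentzian in ∀ (L' : lorentzGroup) (cc : E4) (a : ℝ) {ρ : ℝ}, 0 < ρ → ∀ (z : E4), Kerr.radius (ρ⁻¹ * a) ((((L' : E4 ≃L[ℝ] E4).symm : E4 ≃L[ℝ] E4) : E4 →L[ℝ] E4) (ρ⁻¹ • (z - cc))) = ρ⁻¹ * Kerr.radius a (poincareInv L' cc z) :=
  fun L' cc a _ hρ z ↦ higherOrder_summand_radius L' cc a hρ z

end Summit.FinalStateConjecture.FinalStateConjecture.Theorems.SublinearIsFree.Slaving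

end
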